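import Mathlib
import Summits.Ventures.HodgeRepro.Tier4.Line1.RTFSetting
import Summits.Ventures.HodgeRepro.Tier4.Line1.CentralVanishing

/-!
# Tier4/Line1/CentralVanishingOrbital — LINE L1: the central-character obstruction, orbit by orbit

Blind re-derivation cell `pub-hodge-repro`, Tier 4 «prove the step» (README §9–§10), seat t4-L1-p4 (gen 3; bus
S13375 / S13414).  Companion of `Tier4/Line1/CentralVanishing.lean` (p678622), split out only because of the gate's
400-line rule; imports ONLY Mathlib, the generic RTF layer `Tier4/Line1/RTFSetting.lean` and `CentralVanishing`.

WHAT IS PROVED.  The same substitution `(t, t′) ↦ (zt, zt′)` as in `J_eq_mul_J_of_central`, for ONE rational double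
coset `o`: the partial kernel `K_{f,o}(x, y) = Σ_{γ ∈ o} f(x⁻¹ γ y)` has the same three invariances — central
(`z⁻¹ γ z = γ`), left by `T(k)` in the first variable and left by `T′(k)` in the second (the reindexings `δ ↦ γ⁻¹δ`,
`δ ↦ δγ` stay INSIDE the double coset: `orbitOf_mul_left_of_mem` / `orbitOf_mul_right_of_mem` from
`DoubleCoset.eq`) — so

* **`rtfIntegral_eq_mul_of_central`** — the substitution argument for an arbitrary kernel-like `K : G → G → ℂ` with
  the three invariances: `∫_{DT}∫_{DT′} K(t,t′) χ(t) conj χ′(t′) = χ(z) conj χ′(z) · (the same integral)`;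
* **`orbital_eq_mul_orbital_of_central`** — `orbital(o)(f) = χ(z) · conj χ′(z) · orbital(o)(f)` for every `o`,
  every central `z ∈ Z` and EVERY `f`;
* **`orbital_eq_zero_of_ne_on_centre`** — when `χ(z) ≠ χ′(z)` for one `z ∈ Z`, every orbital term of every `f`
  vanishes (the scope clause's «every regular orbital integral has the central factor `∫_{[Z]} ε(z) dz = 0`», here
  for EVERY orbit, regular or not);
* **`centralMatch_of_orbital_ne_zero`** — one non-zero orbital term forces N2 (`CentralMatch χ χ′`), with neither
  `IsTest f` nor the isolation of the orbit (the sharpening of `centralMatch_of_isolated`).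

No instance is built; every statement is over EVERY `RTF.Setting G` with `[Countable S.Gk]` as the only extra
instance.  Nothing here says anything about the status of the Hodge conjecture for CM abelian varieties, which is
NOT proved (HC_CM is NOT proved by anyone in this repository).
-/

set_option autoImplicit false

noncomputable section

namespace Summit.Ventures.HodgeRepro.Tier4.Line1

open MeasureTheory Topology

namespace RTF

variable {G : Type} [Group G] [TopologicalSpace G] [IsTopologicalGroup G] [MeasurableSpace G]
  [BorelSpace G]

namespace Setting

variable (S : Setting G)

omit [IsTopologicalGroup G] [BorelSpace G] in
/-- Left translation by `γ ∈ T(k)` preserves the rational double coset. -/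
theorem orbitOf_mul_left_of_mem {γ : S.Gk} (hγ : γ ∈ S.Tk) (δ : S.Gk) :
    S.orbitOf (γ * δ) = S.orbitOf δ := by
  unfold orbitOf
  rw [DoubleCoset.eq]
  exact ⟨γ⁻¹, S.Tk.inv_mem hγ, 1, S.T'k.one_mem, by simp⟩

omit [IsTopologicalGroup G] [BorelSpace G] in
/-- Right translation by `γ ∈ T′(k)` preserves the rational double coset. -/
theorem orbitOf_mul_right_of_mem {γ : S.Gk} (hγ : γ ∈ S.T'k) (δ : S.Gk) :
    S.orbitOf (δ * γ) = S.orbitOf δ := by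
  unfold orbitOf
  rw [DoubleCoset.eq]
  exact ⟨1, S.Tk.one_mem, γ⁻¹, S.T'k.inv_mem hγ, by simp [mul_assoc]⟩

omit [IsTopologicalGroup G] [BorelSpace G] in
/-- The partial kernel of a double coset is invariant under the simultaneous central translation of both
variables. -/
theorem partialKernel_central_mul_left (o : S.Orbit) (f : G → ℂ) {z : G} (hz : z ∈ S.Z) (x y : G) :
    S.partialKernel o f (z * x) (z * y) = S.partialKernel o f x y := by
  unfold partialKernel
  refine tsum_congr fun γ => ?_
  congr 1
  have hc : z⁻¹ * (γ.1 : G) * z = γ.1 := by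
    rw [mul_assoc, ← S.central z hz γ.1, ← mul_assoc, inv_mul_cancel, one_mul]
  calc (z * x)⁻¹ * γ.1 * (z * y) = x⁻¹ * (z⁻¹ * γ.1 * z) * y := by
        simp only [mul_inv_rev, mul_assoc]
    _ = x⁻¹ * γ.1 * y := by rw [hc]

omit [IsTopologicalGroup G] [BorelSpace G] in
/-- The partial kernel of a double coset is invariant under left translation of the first variable by `T(k)`
(reindex `δ ↦ γ⁻¹δ` inside the double coset). -/
theorem partialKernel_rational_mul_left (o : S.Orbit) (f : G → ℂ) {γ : S.Gk} (hγ : γ ∈ S.Tk) (x y : G) :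
    S.partialKernel o f ((γ : G) * x) y = S.partialKernel o f x y := by
  unfold partialKernel
  have h : ∀ δ : {δ : S.Gk // S.orbitOf δ = o},
      f (((γ : G) * x)⁻¹ * δ.1 * y) = f (x⁻¹ * ((γ⁻¹ * δ.1 : S.Gk) : G) * y) := by
    intro δ
    congr 1
    simp only [Subgroup.coe_mul, Subgroup.coe_inv, mul_inv_rev, mul_assoc]
  simp_rw [h]
  let e : {δ : S.Gk // S.orbitOf δ = o} ≃ {δ : S.Gk // S.orbitOf δ = o} :=
    Equiv.subtypeEquiv (Equiv.mulLeft γ⁻¹) (fun δ => by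
      simp only [Equiv.coe_mulLeft, S.orbitOf_mul_left_of_mem (S.Tk.inv_mem hγ)])
  exact e.tsum_eq (fun δ : {δ : S.Gk // S.orbitOf δ = o} => f (x⁻¹ * (δ.1 : G) * y))

omit [IsTopologicalGroup G] [BorelSpace G] in
/-- The partial kernel of a double coset is invariant under left translation of the second variable by `T′(k)`
(reindex `δ ↦ δγ` inside the double coset). -/
theorem partialKernel_rational_mul_right (o : S.Orbit) (f : G → ℂ) {γ : S.Gk} (hγ : γ ∈ S.T'k) (x y : G) :
    S.partialKernel o f x ((γ : G) * y) = S.partialKernel o f x y := by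
  unfold partialKernel
  have h : ∀ δ : {δ : S.Gk // S.orbitOf δ = o},
      f (x⁻¹ * δ.1 * ((γ : G) * y)) = f (x⁻¹ * ((δ.1 * γ : S.Gk) : G) * y) := by
    intro δ
    congr 1
    simp only [Subgroup.coe_mul, mul_assoc]
  simp_rw [h]
  let e : {δ : S.Gk // S.orbitOf δ = o} ≃ {δ : S.Gk // S.orbitOf δ = o} :=
    Equiv.subtypeEquiv (Equiv.mulRight γ) (fun δ => by
      simp only [Equiv.coe_mulRight, S.orbitOf_mul_right_of_mem hγ])
  exact e.tsum_eq (fun δ : {δ : S.Gk // S.orbitOf δ = o} => f (x⁻¹ * (δ.1 : G) * y))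

/-- **The substitution argument for an arbitrary kernel-like function** `K : G → G → ℂ` with the three invariances
(central: `K(zx, zy) = K(x, y)`; left by `T(k)` in the first variable; left by `T′(k)` in the second):
`∫_{DT}∫_{DT′} K(t,t′) χ(t) conj χ′(t′) = χ(z) conj χ′(z) · (the same integral)` — the proof of
`J_eq_mul_J_of_central` with `K` in place of the kernel. -/
theorem rtfIntegral_eq_mul_of_central [Countable S.Gk] {χ : S.T → ℂ} {χ' : S.T' → ℂ}
    (hχ : S.IsCharacter χ) (hχ' : S.IsCharacter' χ') {z : G} (hz : z ∈ S.Z) (K : G → G → ℂ)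
    (hK0 : ∀ x y, K (z * x) (z * y) = K x y)
    (hKl : ∀ γ : S.Gk, (γ : G) ∈ S.T → ∀ x y, K ((γ : G) * x) y = K x y)
    (hKr : ∀ γ : S.Gk, (γ : G) ∈ S.T' → ∀ x y, K x ((γ : G) * y) = K x y) :
    (∫ t in S.DT, ∫ t' in S.DT', K t t' * χ t * starRingEnd ℂ (χ' t') ∂S.μT' ∂S.μT) =
      χ ⟨z, S.ZleT hz⟩ * starRingEnd ℂ (χ' ⟨z, S.ZleT' hz⟩) *
        ∫ t in S.DT, ∫ t' in S.DT', K t t' * χ t * starRingEnd ℂ (χ' t') ∂S.μT' ∂S.μT := by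
  set zT : S.T := ⟨z, S.ZleT hz⟩ with hzT
  set zT' : S.T' := ⟨z, S.ZleT' hz⟩ with hzT'
  set c : ℂ := χ zT * starRingEnd ℂ (χ' zT') with hc
  have step1 : ∀ t : S.T,
      ∫ t' in S.DT', K t t' * χ t * starRingEnd ℂ (χ' t') ∂S.μT' =
      ∫ t' in S.DT', K t (zT' * t') * χ t * starRingEnd ℂ (χ' (zT' * t')) ∂S.μT' := by
    intro t
    refine (S.setIntegral_DT'_central_mul hz
      (fun t' : S.T' => K t t' * χ t * starRingEnd ℂ (χ' t')) ?_).symm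
    intro g t'
    have hg : ((g : S.T') : G) ∈ S.Gk := Subgroup.mem_subgroupOf.mp g.2
    have hk : K t ((g • t' : S.T') : G) = K t t' := by
      rw [Subgroup.smul_def, smul_eq_mul, Subgroup.coe_mul]
      exact hKr ⟨_, hg⟩ (g : S.T').2 t t'
    have hχg : χ' (g • t') = χ' t' := by
      rw [Subgroup.smul_def, smul_eq_mul, hχ'.map_mul, hχ'.rational _ g.2, one_mul]
    simp only [hk, hχg]
  have step2 :
      ∫ t in S.DT, (∫ t' in S.DT', K t (zT' * t') * χ t * starRingEnd ℂ (χ' (zT' * t')) ∂S.μT') ∂S.μT =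
      ∫ t in S.DT, (∫ t' in S.DT', K (zT * t) (zT' * t') * χ (zT * t) *
        starRingEnd ℂ (χ' (zT' * t')) ∂S.μT') ∂S.μT := by
    refine (S.setIntegral_DT_central_mul hz
      (fun t : S.T => ∫ t' in S.DT', K t (zT' * t') * χ t * starRingEnd ℂ (χ' (zT' * t')) ∂S.μT')
      ?_).symm
    intro g t
    have hg : ((g : S.T) : G) ∈ S.Gk := Subgroup.mem_subgroupOf.mp g.2
    have hk : ∀ t' : S.T', K ((g • t : S.T) : G) ((zT' : G) * t') = K t ((zT' : G) * t') := by
      intro t'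
      rw [Subgroup.smul_def, smul_eq_mul, Subgroup.coe_mul]
      exact hKl ⟨_, hg⟩ (g : S.T).2 t (zT' * t')
    have hχg : χ (g • t) = χ t := by
      rw [Subgroup.smul_def, smul_eq_mul, hχ.map_mul, hχ.rational _ g.2, one_mul]
    simp only [hk, hχg]
  have step3 : ∀ (t : S.T) (t' : S.T'),
      K (zT * t) (zT' * t') * χ (zT * t) * starRingEnd ℂ (χ' (zT' * t')) =
      c * (K t t' * χ t * starRingEnd ℂ (χ' t')) := by
    intro t t'
    have hk : K ((zT : G) * t) ((zT' : G) * t') = K t t' := hK0 t t'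
    rw [hk, hχ.map_mul, hχ'.map_mul, map_mul, hc]
    ring
  calc ∫ t in S.DT, ∫ t' in S.DT', K t t' * χ t * starRingEnd ℂ (χ' t') ∂S.μT' ∂S.μT
      = ∫ t in S.DT, ∫ t' in S.DT', K t (zT' * t') * χ t * starRingEnd ℂ (χ' (zT' * t'))
          ∂S.μT' ∂S.μT := by
        simp only [step1]
    _ = ∫ t in S.DT, ∫ t' in S.DT', K (zT * t) (zT' * t') * χ (zT * t) *
          starRingEnd ℂ (χ' (zT' * t')) ∂S.μT' ∂S.μT := step2
    _ = ∫ t in S.DT, ∫ t' in S.DT', c * (K t t' * χ t * starRingEnd ℂ (χ' t')) ∂S.μT' ∂S.μT := by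
        simp only [step3]
    _ = c * ∫ t in S.DT, ∫ t' in S.DT', K t t' * χ t * starRingEnd ℂ (χ' t') ∂S.μT' ∂S.μT := by
        simp only [integral_const_mul]

/-- **`orbital(o)(f) = χ(z) · conj χ′(z) · orbital(o)(f)` for every double coset `o`, every central `z ∈ Z` and EVERY
`f`** — the substitution argument on the partial kernel. -/
theorem orbital_eq_mul_orbital_of_central [Countable S.Gk] {χ : S.T → ℂ} {χ' : S.T' → ℂ}
    (hχ : S.IsCharacter χ) (hχ' : S.IsCharacter' χ') {z : G} (hz : z ∈ S.Z) (o : S.Orbit) (f : G → ℂ) :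
    S.orbital χ χ' o f =
      χ ⟨z, S.ZleT hz⟩ * starRingEnd ℂ (χ' ⟨z, S.ZleT' hz⟩) * S.orbital χ χ' o f := by
  unfold orbital
  exact S.rtfIntegral_eq_mul_of_central hχ hχ' hz (S.partialKernel o f)
    (fun x y => S.partialKernel_central_mul_left o f hz x y)
    (fun γ hγ x y => S.partialKernel_rational_mul_left o f (Subgroup.mem_subgroupOf.mpr hγ) x y)
    (fun γ hγ x y => S.partialKernel_rational_mul_right o f (Subgroup.mem_subgroupOf.mpr hγ) x y)

/-- **Every orbital term vanishes when the characters differ on the centre**: `χ(z) ≠ χ′(z)` for one `z ∈ Z` ⟹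
`orbital(o)(f) = 0` for every double coset `o` and every `f` — the scope clause's «every orbital integral has the
central factor `∫_{[Z]} ε = 0`», with no regularity assumption on the orbit. -/
theorem orbital_eq_zero_of_ne_on_centre [Countable S.Gk] {χ : S.T → ℂ} {χ' : S.T' → ℂ}
    (hχ : S.IsCharacter χ) (hχ' : S.IsCharacter' χ') {z : G} (hz : z ∈ S.Z)
    (hne : χ ⟨z, S.ZleT hz⟩ ≠ χ' ⟨z, S.ZleT' hz⟩) (o : S.Orbit) (f : G → ℂ) :
    S.orbital χ χ' o f = 0 := by
  have h := S.orbital_eq_mul_orbital_of_central hχ hχ' hz o f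
  set c : ℂ := χ ⟨z, S.ZleT hz⟩ * starRingEnd ℂ (χ' ⟨z, S.ZleT' hz⟩) with hc
  have hunit : χ' ⟨z, S.ZleT' hz⟩ * starRingEnd ℂ (χ' ⟨z, S.ZleT' hz⟩) = 1 := by
    rw [Complex.mul_conj, Complex.normSq_eq_norm_sq, hχ'.unit]
    simp
  have hc1 : c ≠ 1 := by
    intro h1
    apply hne
    calc χ ⟨z, S.ZleT hz⟩
        = χ ⟨z, S.ZleT hz⟩ * (χ' ⟨z, S.ZleT' hz⟩ * starRingEnd ℂ (χ' ⟨z, S.ZleT' hz⟩)) := by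
          rw [hunit, mul_one]
      _ = (χ ⟨z, S.ZleT hz⟩ * starRingEnd ℂ (χ' ⟨z, S.ZleT' hz⟩)) * χ' ⟨z, S.ZleT' hz⟩ := by ring
      _ = χ' ⟨z, S.ZleT' hz⟩ := by rw [← hc, h1, one_mul]
  have h0 : (1 - c) * S.orbital χ χ' o f = 0 := by
    rw [sub_mul, one_mul, ← h, sub_self]
  rcases mul_eq_zero.mp h0 with h1 | h1
  · exact absurd (sub_eq_zero.mp h1).symm hc1
  · exact h1

/-- **A non-zero orbital term forces N2**: `orbital(o)(f) ≠ 0` for one orbit and one `f` implies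
`CentralMatch χ χ′` — the sharpening of `centralMatch_of_isolated` that needs neither `IsTest f` nor the isolation
of the orbit. -/
theorem centralMatch_of_orbital_ne_zero [Countable S.Gk] {χ : S.T → ℂ} {χ' : S.T' → ℂ}
    (hχ : S.IsCharacter χ) (hχ' : S.IsCharacter' χ') {o : S.Orbit} {f : G → ℂ}
    (hne : S.orbital χ χ' o f ≠ 0) : S.CentralMatch χ χ' := by
  intro z hz
  by_contra hzne
  exact hne (S.orbital_eq_zero_of_ne_on_centre hχ hχ' hz hzne o f)

end Setting

end RTF

end Summit.Ventures.HodgeRepro.Tier4.Line1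

end
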